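import Literature.AnabelianGeometry.SemiGraphs.TemperedCoverings
import Mathlib.Data.Finite.Prod
import Mathlib.Algebra.Group.Action.Basic
import HarnessLib

/-!
# Semi-graphs of anabelioids, §3: proof of the named fact `FiniteIsTempered`

Mochizuki, *Semi-graphs of anabelioids*, Publ. RIMS **42** (2006), §3, Definition 3.5 (i)–(ii),
manuscript p. 37 [cite: MochizukiSemiAnbd2006, Def 3.5(ii) p.37]: "coverings of semi-graphs of
anabelioids that arise from finite objects of `B^cov(G)` determine finite étale coverings" and
"we have natural full embeddings `B(G) ↪ B^temp(G) ↪ B^cov(G)`" — i.e. every FINITE object of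
`B^cov(G)` is tempered.  The statement file
`Literature.AnabelianGeometry.SemiGraphs.TemperedCoverings` records this as the named fact
`ProfiniteSemiGraph.FiniteIsTempered` (abc-iut cell node `SemiAnbd:Def3.5(ii)`, printed-claim
part); this proof-only companion discharges it AS TYPED (`FiniteIsTempered_holds`).

Proof (elementary, no Galois-category machinery): for a finite object `S = {S_v, S_e, glue}` of
`B^cov(G)` consider its *frame object* `F` with `F_c := Perm(S_c)`, the set of permutations of the
finite fibre `S_c`, on which `Π_c` acts by post-composition `g · σ := ρ_c(g) ∘ σ`; the gluing
isomorphisms of `F` are obtained from those of `S` by conjugation.  The stabiliser of any `σ` is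
the kernel of the action of `Π_c` on `S_c` (an open subgroup: a finite intersection of open
stabilisers), so `F` is a finite object of `B^cov(G)` with nonempty fibres (the identity
permutations) which splits `S` at EVERY point — in particular at every point of every connected
component, which is the (author-corrected, [IUTchI] Rmk. 2.5.3 (v)) temperedness condition.
The hypotheses "connected" and "countable" of the named fact are not needed for this.

Proof-only file: no definitions; nothing of the statement file is restated; the frame object is
built inside the proof.  The `Π`-set of permutations `Perm(X)` of a `Π`-set `X` is written out,
without a definition, as Mathlib's `Action.ofMulAction Π (Equiv.Perm X.V)` for the action
`MulAction.compHom _ (MulAction.toPermHom Π X.V)`, i.e. `g · σ := ρ(g) ∘ σ` (the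
`Π`-action on `X.V` being `Action.instMulAction X`).
-/

open CategoryTheory Topology

namespace Literature.AnabelianGeometry.SemiGraphs

universe u

section Perm

variable {Γ : Type u} [Group Γ]

/-- The action on permutations is post-composition: `(g · σ)(x) = ρ(g)(σ(x))`. [folklore] -/
private theorem permOf_ρ_apply (X : Action (Type u) Γ) (g : Γ) (σ : Equiv.Perm X.V) (x : X.V) :
    DFunLike.coe (F := Equiv.Perm X.V)
      ((@Action.ofMulAction Γ (Equiv.Perm X.V) _ (MulAction.compHom (Equiv.Perm X.V)
        (@MulAction.toPermHom Γ X.V _ (Action.instMulAction X)))).ρ g σ) x = X.ρ g (σ x) :=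
  rfl

/-- `g` fixes the permutation `σ` iff `g` acts trivially on `X`. [folklore] -/
private theorem permOf_ρ_eq_iff (X : Action (Type u) Γ) (g : Γ) (σ : Equiv.Perm X.V) :
    (@Action.ofMulAction Γ (Equiv.Perm X.V) _ (MulAction.compHom (Equiv.Perm X.V)
        (@MulAction.toPermHom Γ X.V _ (Action.instMulAction X)))).ρ g σ = σ ↔
      ∀ x : X.V, X.ρ g x = x := by
  constructor
  · intro h x
    have h1 := congrArg (fun τ : Equiv.Perm X.V => τ (σ.symm x)) h
    have h2 : X.ρ g (σ (σ.symm x)) = σ (σ.symm x) := h1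
    simpa using h2
  · intro h
    refine Equiv.ext fun x => ?_
    exact (permOf_ρ_apply X g σ x).trans (h (σ x))

/-- For a `Π`-set `X` with open stabilisers and finite underlying set, the `Π`-set of
permutations of `X` is an object of `B^temp(Π)` (countable with open stabilisers). [folklore] -/
private theorem permOf_mem [TopologicalSpace Γ] (X : Action (Type u) Γ)
    (hX : ∀ x : X.V, IsOpen {g : Γ | X.ρ g x = x}) [Finite X.V] :
    temperedAction Γ (@Action.ofMulAction Γ (Equiv.Perm X.V) _ (MulAction.compHom (Equiv.Perm X.V)
      (@MulAction.toPermHom Γ X.V _ (Action.instMulAction X)))) := by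
  refine ⟨inferInstanceAs (Countable (Equiv.Perm X.V)), fun σ => ?_⟩
  have hset : {g : Γ | (@Action.ofMulAction Γ (Equiv.Perm X.V) _ (MulAction.compHom
      (Equiv.Perm X.V) (@MulAction.toPermHom Γ X.V _ (Action.instMulAction X)))).ρ g σ = σ} =
      ⋂ x : X.V, {g : Γ | X.ρ g x = x} := by
    ext g
    simp only [Set.mem_setOf_eq, Set.mem_iInter, permOf_ρ_eq_iff]
  change IsOpen {g : Γ | (@Action.ofMulAction Γ (Equiv.Perm X.V) _ (MulAction.compHom
    (Equiv.Perm X.V) (@MulAction.toPermHom Γ X.V _ (Action.instMulAction X)))).ρ g σ = σ}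
  rw [hset]
  exact isOpen_iInter_of_finite fun x => hX x

variable [TopologicalSpace Γ] {Γ' : Type u} [Group Γ'] [TopologicalSpace Γ']

/-- Conjugating by the underlying bijection of an isomorphism `X ≅ φ^* Y` of `Π'`-sets gives an
isomorphism `Perm(X) ≅ φ^* Perm(Y)` of the `Π'`-sets of permutations. [folklore] -/
private theorem nonempty_permOf_iso_res (φ : Γ' →ₜ* Γ) (X : Action (Type u) Γ')
    (Y : Action (Type u) Γ) (i : X ≅ (Action.res (Type u) φ.toMonoidHom).obj Y) :
    Nonempty
      (@Action.ofMulAction Γ' (Equiv.Perm X.V) _ (MulAction.compHom (Equiv.Perm X.V)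
          (@MulAction.toPermHom Γ' X.V _ (Action.instMulAction X))) ≅
        (Action.res (Type u) φ.toMonoidHom).obj
          (@Action.ofMulAction Γ (Equiv.Perm Y.V) _ (MulAction.compHom (Equiv.Perm Y.V)
            (@MulAction.toPermHom Γ Y.V _ (Action.instMulAction Y))))) := by
  -- the underlying bijection of `i` and its equivariance
  let ε : X.V ≃ Y.V := ((Action.forget _ _).mapIso i).toEquiv
  have hε : ∀ (g : Γ') (x : X.V), ε (X.ρ g x) = Y.ρ (φ g) (ε x) := fun g x =>
    ConcreteCategory.congr_hom (i.hom.comm g) x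
  refine ⟨Action.mkIso (Equiv.toIso ε.permCongr) fun g => ?_⟩
  apply ConcreteCategory.hom_ext
  intro σ
  refine Equiv.ext fun y => ?_
  change ε (X.ρ g (DFunLike.coe (F := Equiv.Perm X.V) σ (ε.symm y))) =
    Y.ρ (φ g) (ε (DFunLike.coe (F := Equiv.Perm X.V) σ (ε.symm y)))
  exact hε g _

end Perm

namespace ProfiniteSemiGraph

/-- **[SemiAnbd] Definition 3.5 (i)–(ii), p. 37** ("coverings … that arise from finite objects
of `B^cov(G)` determine finite étale coverings"; "`B(G) ↪ B^temp(G)`"): the named fact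
`FiniteIsTempered` HOLDS — every finite object `S` of `B^cov(G)` is tempered.  Witness: the frame
object `F = {Perm(S_c)}` of `S`, a finite object with nonempty fibres splitting `S` at every point.
(abc-iut node `SemiAnbd:Def3.5(ii)`, discharged as typed; the hypotheses "connected, countable"
are not used.) [cite: MochizukiSemiAnbd2006, Def 3.5(ii) p.37] -/
theorem FiniteIsTempered_holds : FiniteIsTempered.{u} := by
  intro 𝒢 _ _ S hS p
  classical
  haveI hfinV : ∀ v, Finite (S.SV v).obj.V := hS.finite_V
  haveI hfinE : ∀ e, Finite (S.SE e).obj.V := hS.finite_E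
  -- the frame object of `S`: `F_c = Perm(S_c)`, gluing by conjugation
  let F : CovObj 𝒢 :=
    { SV := fun v => ⟨_, permOf_mem (S.SV v).obj (S.SV v).property.2⟩
      SE := fun e => ⟨_, permOf_mem (S.SE e).obj (S.SE e).property.2⟩
      glue := fun b v h =>
        (temperedAction (𝒢.Ge (𝒢.graph.edgeOf b))).isoMk
          (Classical.choice (nonempty_permOf_iso_res (𝒢.brHom b v h)
            (S.SE (𝒢.graph.edgeOf b)).obj (S.SV v).obj
            ((temperedAction (𝒢.Ge (𝒢.graph.edgeOf b))).ι.mapIso (S.glue b v h)))) }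
  refine ⟨F, ⟨fun v => ?_, fun e => ?_⟩, ⟨fun v => ?_, fun e => ?_⟩, fun q _ => ?_⟩
  · exact inferInstanceAs (Finite (Equiv.Perm (S.SV v).obj.V))
  · exact inferInstanceAs (Finite (Equiv.Perm (S.SE e).obj.V))
  · exact ⟨(Equiv.refl _ : Equiv.Perm (S.SV v).obj.V)⟩
  · exact ⟨(Equiv.refl _ : Equiv.Perm (S.SE e).obj.V)⟩
  · rcases q with ⟨v, s⟩ | ⟨e, s⟩
    · dsimp only [CovObj.SplitsAt]
      intro σ g hσ
      exact (permOf_ρ_eq_iff (S.SV v).obj g σ).mp hσ s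
    · dsimp only [CovObj.SplitsAt]
      intro σ g hσ
      exact (permOf_ρ_eq_iff (S.SE e).obj g σ).mp hσ s

/-- The print-faithful, (E7)-guarded form of [SemiAnbd] Definition 3.5 (ii) "`B(G) ↪ B^temp(G)`":
the author's erratum [IUTchI] Remark 2.5.3 (ii) (E7), p. 54, asks that `G` be Galois-countable
throughout [SemiAnbd] 3.5–3.9.  The typed named fact `FiniteIsTempered` is STRONGER (it carries no
Galois-countability hypothesis) and is proved above (`FiniteIsTempered_holds`), so the guarded
form follows at once (abc-iut cell, L3-lead RULING ξ resolving referee finding E2-F1 by proof; the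
hypotheses are deliberately unused). [cite: MochizukiSemiAnbd2006, Def 3.5(ii) p.37]
[cite: Mochizuki2012, IUTchI Rmk 2.5.3 (ii) (E7), p. 54] -/
theorem FiniteIsTempered_of_isGaloisCountable (𝒢 : ProfiniteSemiGraph.{u})
    (hconn : 𝒢.graph.IsConnected) (hcount : 𝒢.IsCountable) (_hGal : 𝒢.IsGaloisCountable)
    (S : CovObj 𝒢) (hS : S.IsFinite) : S.IsTempered :=
  FiniteIsTempered_holds 𝒢 hconn hcount S hS

end ProfiniteSemiGraph

end Literature.AnabelianGeometry.SemiGraphs
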